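import Literature.NumberTheory.Transcendental.SemistabilityInduction
import Literature.NumberTheory.Transcendental.PhilipponZeroEstimateStdProofs
import Literature.NumberTheory.Transcendental.SemistabilityStdOfPhilippon
import HarnessLib

/-!
# The analytic subgroup theorem for `𝔾ₐ × 𝔾ₘ^ι × (E♮)^κ` (at period vectors, and at all algebraic points): discharge

Topic: `Literature/NumberTheory/Transcendental`. Companion `…Proofs` file (D-0014) of
`AnalyticSubgroupElliptic.lean` (which cannot import the semistability chain: that chain imports
it). The named facts are PROVED in one line each, now that Philippon's zero estimate
`philippon1986_std` is discharged (`philippon1986_std_holds`, `PhilipponZeroEstimateStdProofs.lean`):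

* `analyticSubgroupTheorem_GaGmE_periods_holds : analyticSubgroupTheorem_GaGmE_periods` —
  Wüstholz's analytic subgroup theorem for `G = 𝔾ₐ × 𝔾ₘ^ι × (E♮)^κ` (non-CM `E` over `ℚ̄`) at
  points lying over the origin of `(E♮)^κ` (period vectors), hyperplane form
  (`AnalyticSubgroupElliptic.lean`): the tree's reduction
  `analyticSubgroupTheorem_GaGmE_periods_of_philippon` (Baker's method on the theta model of
  `M_κ`, the semistability induction of `SemistabilityInduction.lean`, the torsion dévissage)
  applied to `philippon1986_std_holds` (its siblings `HuberWustholzOnePeriods_holds`,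
  `masser_ellipticPeriods_holds` live in `OnePeriodsProofs.lean`).

* `analyticSubgroupTheorem_GaGmE_holds : analyticSubgroupTheorem_GaGmE` — the same theorem at
  ALL algebraic points `u = (x; (y_i); (z_k, t_k))` of `Lie(𝔾ₐ × 𝔾ₘ^ι × (E♮)^κ)` (`x ∈ ℚ̄`,
  `e^{y_i} ∈ ℚ̄`, `(z_k, t_k)` exponentiating to `ℚ̄`-points of `E♮`): the tree's reduction
  `analyticSubgroupTheorem_GaGmE_of_philippon` of `SemistabilityStdOfPhilippon.lean` (the
  Baker–Wüstholz Semistability Theorem 6.15 for `M_κ` at every algebraic point,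
  `semistabilityTheorem_std_of_philippon` — Baker's method at a general algebraic point,
  `BakerFieldG` … `BakerNumericsG`, with the reduced-multiple trick — followed by the dévissage
  `analyticSubgroupTheorem_GaGmE_of_std` of `SemistableQuotients.lean`) applied to
  `philippon1986_std_holds`.

Consequences already wired in the tree become unconditional by feeding these theorems to their
users `(h : analyticSubgroupTheorem_GaGmE_periods)` / `(h : analyticSubgroupTheorem_GaGmE)`, e.g.
`CurvePeriods.huberWustholzCurvePeriods_of_puncturedLine_or_ellipticLoops` (Huber–Wüstholz 2022,
Thm. 13.3 (2) for genus `0` and closed paths on a non-CM elliptic curve,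
`CurvePeriodsEllipticEndgameProofs.lean`), `CurvePeriods.huberWustholzCurvePeriods_of_puncturedLine_or_ellipticPaths`
(the same with ARBITRARY paths on the elliptic curve, `CurvePeriodsEllipticPathsProofs.lean`) and
the route item `OnePeriodNeedsTwoVariables` of
`Summits/KontsevichZagierPeriods/…/Theses/HodgeLevel.lean`.

## References

* G. Wüstholz, *Algebraische Punkte auf analytischen Untergruppen algebraischer Gruppen*,
  Ann. of Math. 129 (1989), 501–517 — the analytic subgroup theorem. [Wustholz1989]
* A. Huber, G. Wüstholz, *Transcendence and Linear Relations of 1-Periods*, Cambridge Tracts in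
  Mathematics 227, CUP 2022: Thm. 6.1, Thm. 6.2, Thm. 15.3 (1). [HuberWustholz2022]
* A. Baker, G. Wüstholz, *Logarithmic Forms and Diophantine Geometry*, CUP 2007: Thm. 6.1, §6.2,
  Thm. 6.15, §6.8. [BakerWustholz2007]
* P. Philippon, *Lemmes de zéros dans les groupes algébriques commutatifs*, Bull. Soc. Math.
  France 114 (1986), 355–383, Thm. 2.1. [Philippon1986]
-/

noncomputable section

namespace Literature.NumberTheory.Transcendental

/-- **The analytic subgroup theorem for `𝔾ₐ × 𝔾ₘ^ι × (E♮)^κ` at period vectors holds** (non-CM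
`E` with `g₂, g₃ ∈ ℚ̄`): if the coordinates of `u = (x; (y_i); (m_kω₁ + n_kω₂, m_kη₁ + n_kη₂))`
with `x ∈ ℚ̄`, `e^{y_i} ∈ ℚ̄` are `ℚ̄`-linearly dependent, then `x = 0`, or `Σ p_i y_i = 0` for some
`0 ≠ p ∈ ℤ^ι`, or `Σ a_k (m_kω₁ + n_kω₂) = 0` for some `0 ≠ a ∈ ℤ^κ`.
[cite: HuberWustholz2022, Thm. 6.2 and Thm. 6.1; Thm. 15.3 (1)] [cite: Wustholz1989, the analytic subgroup theorem] [cite: BakerWustholz2007, Thm. 6.1, §6.2] [cite: Philippon1986, Thm. 2.1] -/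
theorem analyticSubgroupTheorem_GaGmE_periods_holds : analyticSubgroupTheorem_GaGmE_periods :=
  analyticSubgroupTheorem_GaGmE_periods_of_philippon philippon1986_std_holds

/-- **Wüstholz's analytic subgroup theorem for `G = 𝔾ₐ × 𝔾ₘ^ι × (E♮)^κ`, hyperplane form, holds**
(`Λ = ℤω₁ + ℤω₂` with `g₂, g₃ ∈ ℚ̄` and without complex multiplication, `E : y² = 4x³ - g₂x - g₃`,
`E♮` its universal vectorial extension): if `u = (x; (y_i); (z_k, t_k)) ∈ Lie G_ℂ` has
`exp_G(u) ∈ G(ℚ̄)` — `x ∈ ℚ̄`, `e^{y_i} ∈ ℚ̄`, each `(z_k, t_k)` a `ℚ̄`-point of `E♮`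
(`PeriodPair.IsUnivExtAlgPoint`) — and the `1 + |ι| + 2|κ|` coordinates of `u` are `ℚ̄`-linearly
dependent, then `x = 0`, or `Σ p_i y_i = 0` for some `0 ≠ p ∈ ℤ^ι`, or `Σ a_k z_k = 0` for some
`0 ≠ a ∈ ℤ^κ`. PROVED: the Baker–Wüstholz Semistability Theorem for the explicit group varieties
`M_κ` at every algebraic point (`semistabilityTheorem_std_of_philippon`, Baker's method, fed with
Philippon's zero estimate `philippon1986_std_holds`) and the dévissage
`analyticSubgroupTheorem_GaGmE_of_std` (maximal semistable quotients, torsion, the structure of the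
connected algebraic subgroups of `G` for non-CM `E`), composed in the tree as
`analyticSubgroupTheorem_GaGmE_of_philippon`.
[cite: HuberWustholz2022, Thm. 6.2 and Thm. 6.1; Prop. 4.18, Prop. 4.20, Lemma 8.13, §18.1] [cite: Wustholz1989, the analytic subgroup theorem] [cite: BakerWustholz2007, Thm. 6.1, Thm. 6.15, §6.7–6.8] [cite: Philippon1986, Thm. 2.1] -/
theorem analyticSubgroupTheorem_GaGmE_holds : analyticSubgroupTheorem_GaGmE :=
  analyticSubgroupTheorem_GaGmE_of_philippon philippon1986_std_holds

end Literature.NumberTheory.Transcendental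

end
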